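import Summits.BirchSwinnertonDyer.BirchSwinnertonDyer.Theorems.EisensteinPrimesCharResidualSelmerKummer
import Literature.NumberTheory.EllipticCurves.SubgroupSelmerCocycleCriteriaProofs
import Literature.NumberTheory.GaloisRepresentations.LocalGaloisGroupProofs
import HarnessLib

/-!
# `H¹_{𝓕_Gr^{S₀}}(K_∞, M) = H¹_{𝓕_nr^{S₀}}(K_∞, M)` when `M` has no non-zero vector fixed by the inertia group
# of `K_∞` above `v̄` — the strict/unramified index at `v̄` VANISHES for the `ω̃`-type character
# (cell `bsd-eis`, seat `bsd-line-x1-p1-w4` gen 3, D-0154 WIDTH PASS; crux 2 `GoodLatticeBDPValue`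
# stmt-BirchSwinnertonDyer-19032, line `halves` v19.1, V20 road to `stub_imprimLambda` = KY Thm. 1.4.1 (iii))

HONEST FRAMING (cell `bsd-eis`, run/shared/lean/pub/bsd-eis/): Galois-cohomology bookkeeping on constructed
objects; no definition, no named fact, no `sorry`, no `Theses` import; nothing about any curve is asserted;
BSD / IMC2 / KY Thm. 1.4.1 are proved for NO curve. Helper `--supports stmt-BirchSwinnertonDyer-19032`.

## Why
The V20 road (LEAD g4, HOME STATUS l.3172; memo `Cruxes/GoodLatticeBDPValue/Lines/halves-imprimLambda-road.md`)
counts residual Selmer groups over `K_∞`. Two currencies meet at `v̄`: the `E`-side dévissage files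
(`ResidualDevissageCount*`, x2-p2) use Castella's STRICT condition at `v̄` (`datumStrictSelmer … bdpData`,
= `KellerYin2024.grSelmer`), while the character `λ`-invariants of the crux (`stub_imprimLambda`'s `DSsub`,
`DSquot`) are duals of the UNRAMIFIED groups `KellerYin2024.unrSelmer`, to which brick (b)
(`CharResidualSelmerCount`, this seat) attaches the residual count. This file is the bridge at `v̄` in the
case where it is an EQUALITY: Keller–Yin's remark that for `θ|_{G_v̄} = ω` "both `M_ω̃^{G_v̄}` and
`M_ω̃[𝔭]^{G_v̄}` are `0`", so the Greenberg and unramified conditions at `v̄` coincide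
(arXiv:2402.12781v2, proof of Lemma 1.2.4, TeX L790–795: "if `θ|_{G_v̄} = ω`, the above two diagrams agree").
In the tree's `K_∞`-currency, for ANY discrete `Γ_K`-module `M`, ANY `H ≤ Γ_K` and ANY finite place `v`:

* §1 `conj_mem_inertia`: `I_v ⊴ D_v` for the tree's chosen-embedding groups (`GreenbergSelmer.inertia`,
  `.decomp`), from `I_F ⊴ Γ_F` (`absInertia_normal_holds`).
* §2 **inflation–restriction, vanishing case** (explicit cocycles, no continuity input): if `M` has no
  non-zero vector fixed by `H ⊓ I_v`, a class of `H¹(H, M)` that dies on `H ⊓ I_v` (`unramifiedKer`) dies on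
  `H ⊓ D_v` (`resOfLe … = 0`): for a cocycle `z` with `z|_{H⊓I_v} = ∂a`, the corrected `w = z − ∂a` satisfies
  `n·w(x) = w(nx) = w(x·x⁻¹nx) = w(x)` for `x ∈ H ⊓ D_v`, `n ∈ H ⊓ I_v`, so `w(x) ∈ M^{H⊓I_v} = 0`.
* §3 **Selmer level**: `grSelmer κ M v̄ S₀ = unrSelmer κ M v̄ S₀` under that hypothesis at `v̄`
  (Castella's strict condition = "dies on `H ⊓ D_v̄`", Greenberg's condition for the strict datum = "dies on
  `H ⊓ I_v̄`"; all conjugates at once, the hypothesis being conjugation-invariant); hence the residual and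
  the `p^∞`-level statements for every `Γ_K`-module without `(ker κ ⊓ I_v̄)`-fixed vectors — the `ω̃`-type
  character `(F/𝒪)(ω̃)` and its residual line `𝔽(ω̃)` (a Teichmüller character non-trivial on `I_v̄` stays
  non-trivial on the pro-`p`-index subgroup `ker κ ⊓ I_v̄`; that discharge is the consumer's, from the residual pair).

NOT here: the `𝟙̃`-type character (locally trivial at `v̄`), where `R_nr/R_Gr` at `v̄` is NON-zero (KY:
`ker(r_{M_𝟙̃[𝔭]}) = 𝔽`, index `≤ p` per place of `K_∞` above `v̄`) — the anomalous local term of brick (e).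

References: [KellerYin2024] Lemma 1.2.4 and its proof (arXiv:2402.12781v2 TeX L736–800); [Greenberg1989] §1
p. 98 ("replace `I_v` by `D_v` … the strict Selmer group"); [SerreGaloisCohomology1997] I.§2.6 (b)
(inflation–restriction); [SerreLocalFields1979] Ch. I §7 Prop. 20 (`I ⊴ D`).
-/

set_option autoImplicit false
set_option linter.dupNamespace false -- the summit namespace `…BirchSwinnertonDyer.BirchSwinnertonDyer.Theorems` (Sub = Summit, D-0017) trips it

noncomputable section

open scoped Classical

namespace Summit.BirchSwinnertonDyer.BirchSwinnertonDyer.Theorems.CharResidualSelmerCount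

open NumberField IsDedekindDomain Field
open Literature.NumberTheory.EllipticCurves Literature.NumberTheory.EllipticCurves.GreenbergSelmer
  Literature.NumberTheory.EllipticCurves.GreenbergVatsal2000 Literature.NumberTheory.GaloisRepresentations
  Literature.NumberTheory.EllipticCurves.KellerYin2024

/-! ### §1 `I_v ⊴ D_v` for the chosen embedding -/

section Normal

variable {K : Type} [Field K] [NumberField K]

/-- **`I_v` is normalised by `D_v`**: `x⁻¹ n x ∈ I_v` for `x ∈ D_v`, `n ∈ I_v` (both groups are images of
`Γ_{K_v}` resp. `I_{K_v} ⊴ Γ_{K_v}` under the chosen restriction `Γ_{K_v} → Γ_K`).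
[cite: SerreLocalFields1979, Ch. I §7 Prop. 20] -/
theorem conj_mem_inertia (v : HeightOneSpectrum (𝓞 K)) {x n : absoluteGaloisGroup K}
    (hx : x ∈ decomp v) (hn : n ∈ inertia v) : x⁻¹ * n * x ∈ inertia v := by
  haveI : (absInertia (v.adicCompletion K)).Normal := absInertia_normal_holds (v.adicCompletion K)
  obtain ⟨σ, rfl⟩ := (mem_decomp_iff v x).mp hx
  obtain ⟨τ, hτ, rfl⟩ := Subgroup.mem_map.mp hn
  refine Subgroup.mem_map.mpr ⟨σ⁻¹ * τ * σ, ?_, by simp [map_mul, map_inv]⟩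
  have h := Subgroup.Normal.conj_mem inferInstance τ hτ σ⁻¹
  rwa [inv_inv] at h

end Normal

/-! ### §2 Inflation–restriction, vanishing case: unramified at `v` ⟹ locally trivial at `v` -/

section Local

variable {K : Type} [Field K] [NumberField K] (H : Subgroup (absoluteGaloisGroup K))
  {M : Type} [AddCommGroup M] [DistribMulAction (absoluteGaloisGroup K) M] [TopologicalSpace M]
  [DiscreteTopology M]

/-- **A class of `H¹(H, M)` unramified at `v` is locally trivial at `v` when `M^{H ⊓ I_v} = 0`.** If
`res_{H ⊓ I_v} [z] = 0`, i.e. `z|_{H ⊓ I_v} = ∂a`, then `w := z − ∂a` (still a crossed homomorphism) vanishes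
on `H ⊓ I_v`, and for `x ∈ H ⊓ D_v`, `n ∈ H ⊓ I_v` one has `nx = x·(x⁻¹nx)` with `x⁻¹nx ∈ H ⊓ I_v`, so
`n·w(x) = w(nx) = w(x)`: `w(x)` is fixed by `H ⊓ I_v`, hence `0`; thus `z|_{H ⊓ D_v} = ∂a` and
`res_{H ⊓ D_v} [z] = 0`. (Inflation–restriction: `ker(H¹(D, M) → H¹(I, M)) = H¹(D/I, M^I) = 0`.)
[cite: SerreGaloisCohomology1997, I.§2.6 (b)] [cite: KellerYin2024, proof of Lemma 1.2.4 (arXiv:2402.12781v2 TeX L790–795)] -/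
theorem resOfLe_decomp_eq_zero_of_mem_unramifiedKer_of_noFixed (v : HeightOneSpectrum (𝓞 K))
    (hI : ∀ m : M, (∀ g : absoluteGaloisGroup K, g ∈ H → g ∈ inertia v → g • m = m) → m = 0)
    {c : subgroupH1 H M} (hc : c ∈ unramifiedKer H M v) :
    resOfLe M (inf_le_left : H ⊓ decomp v ≤ H) c = 0 := by
  obtain ⟨z, rfl⟩ := oneCocycleClass_surjective _ c
  rw [GreenbergVatsal2000.unramifiedKer, AddMonoidHom.mem_ker,
    CocycleCriteria.resH1Hom_oneCocycleClass_eq_zero_iff] at hc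
  obtain ⟨a, ha⟩ := hc
  rw [CocycleCriteria.resOfLe_oneCocycleClass_eq_zero_iff]
  refine ⟨a, fun x ↦ ?_⟩
  -- the corrected function `w g = z g - (g • a - a)` on `H`
  let w : H → M := fun g ↦ z.1 g - ((g : absoluteGaloisGroup K) • a - a)
  have hwmul : ∀ g h : H, w (g * h) = w g + (g : absoluteGaloisGroup K) • w h := by
    intro g h
    have hz : z.1 (g * h) = z.1 g + (g : absoluteGaloisGroup K) • z.1 h := z.2 g h
    simp only [w, hz, Subgroup.coe_mul, mul_smul, smul_sub]
    abel
  -- `w` vanishes on `H ⊓ I_v`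
  have hwI : ∀ g : H, (g : absoluteGaloisGroup K) ∈ inertia v → w g = 0 := by
    intro g hg
    have hgD : (g : absoluteGaloisGroup K) ∈ decomp v := inertia_le_decomp v hg
    have key := ha ⟨⟨(g : absoluteGaloisGroup K), hgD⟩, (mem_inertiaIn_iff H v _).2 ⟨g.2, hg⟩⟩
    change z.1 (inertiaInToH H v _) = (g : absoluteGaloisGroup K) • a - a at key
    have e : inertiaInToH H v ⟨⟨(g : absoluteGaloisGroup K), hgD⟩,
        (mem_inertiaIn_iff H v _).2 ⟨g.2, hg⟩⟩ = g := Subtype.ext rfl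
    rw [e] at key
    simp only [w, key, sub_self]
  -- for `x ∈ H ⊓ D_v`, `w x` is fixed by `H ⊓ I_v`, hence `0`
  let xH : H := ⟨(x : absoluteGaloisGroup K), (Subgroup.mem_inf.mp x.2).1⟩
  have hxD : (x : absoluteGaloisGroup K) ∈ decomp v := (Subgroup.mem_inf.mp x.2).2
  have hfix : ∀ g : absoluteGaloisGroup K, g ∈ H → g ∈ inertia v → g • w xH = w xH := by
    intro g hgH hgI
    let n : H := ⟨g, hgH⟩
    -- `m = x⁻¹ n x ∈ H ⊓ I_v`
    have hmI : (x : absoluteGaloisGroup K)⁻¹ * g * x ∈ inertia v := conj_mem_inertia v hxD hgI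
    have hmH : (x : absoluteGaloisGroup K)⁻¹ * g * x ∈ H :=
      H.mul_mem (H.mul_mem (H.inv_mem xH.2) hgH) xH.2
    let m : H := ⟨(x : absoluteGaloisGroup K)⁻¹ * g * x, hmH⟩
    have hnx : n * xH = xH * m := Subtype.ext (by
      change g * (x : absoluteGaloisGroup K) = x * ((x : absoluteGaloisGroup K)⁻¹ * g * x)
      group)
    have h1 : w (n * xH) = g • w xH := by rw [hwmul, hwI n hgI, zero_add]
    have h2 : w (xH * m) = w xH := by rw [hwmul, hwI m hmI, smul_zero, add_zero]
    rw [← h1, hnx, h2]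
  have hw0 : w xH = 0 := hI _ hfix
  have hw0' : z.1 xH - ((x : absoluteGaloisGroup K) • a - a) = 0 := hw0
  have e : Subgroup.inclusion (inf_le_left : H ⊓ decomp v ≤ H) x = xH := Subtype.ext rfl
  rw [e]
  exact sub_eq_zero.mp hw0'

/-- **Equivalently: the unramified and the locally-trivial conditions at `v` coincide** when
`M^{H ⊓ I_v} = 0` (the converse inclusion `awayKer ≤ unramifiedKer` is unconditional: `I_v ≤ D_v`).
[cite: SerreGaloisCohomology1997, I.§2.6 (b)] [cite: Greenberg1989, §1 p. 98] -/
theorem mem_unramifiedKer_iff_resOfLe_decomp_eq_zero_of_noFixed (v : HeightOneSpectrum (𝓞 K))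
    (hI : ∀ m : M, (∀ g : absoluteGaloisGroup K, g ∈ H → g ∈ inertia v → g • m = m) → m = 0)
    (c : subgroupH1 H M) :
    c ∈ unramifiedKer H M v ↔ resOfLe M (inf_le_left : H ⊓ decomp v ≤ H) c = 0 := by
  refine ⟨resOfLe_decomp_eq_zero_of_mem_unramifiedKer_of_noFixed H v hI, fun hc ↦ ?_⟩
  -- restriction to `H ⊓ I_v` factors through `H ⊓ D_v`
  obtain ⟨z, rfl⟩ := oneCocycleClass_surjective _ c
  rw [CocycleCriteria.resOfLe_oneCocycleClass_eq_zero_iff] at hc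
  obtain ⟨a, ha⟩ := hc
  rw [GreenbergVatsal2000.unramifiedKer, AddMonoidHom.mem_ker,
    CocycleCriteria.resH1Hom_oneCocycleClass_eq_zero_iff]
  refine ⟨a, fun y ↦ ?_⟩
  have hy := (mem_inertiaIn_iff H v y).1 y.2
  have key := ha ⟨((y : decomp (K := K) v) : absoluteGaloisGroup K), Subgroup.mem_inf.mpr ⟨hy.1, (y : decomp (K := K) v).2⟩⟩
  have e : Subgroup.inclusion (inf_le_left : H ⊓ decomp v ≤ H)
      ⟨((y : decomp (K := K) v) : absoluteGaloisGroup K), Subgroup.mem_inf.mpr ⟨hy.1, (y : decomp (K := K) v).2⟩⟩ =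
        inertiaInToH H v y := Subtype.ext rfl
  rw [e] at key
  exact key

end Local

/-! ### §3 Selmer level: `H¹_{𝓕_Gr^{S₀}}(K_∞, M) = H¹_{𝓕_nr^{S₀}}(K_∞, M)` when `M^{ker κ ⊓ I_v̄} = 0` -/

section Selmer

variable {K : Type} [Field K] [NumberField K] {p : ℕ} [hp : Fact p.Prime] (κ : ZpExtension K p)
  {M : Type} [AddCommGroup M] [DistribMulAction (absoluteGaloisGroup K) M] [TopologicalSpace M]
  [DiscreteTopology M] (vbar : HeightOneSpectrum (𝓞 K)) (S₀ : Set (HeightOneSpectrum (𝓞 K)))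

/-- **`H¹_{𝓕_Gr^{S₀}}(K_∞, M) = H¹_{𝓕_nr^{S₀}}(K_∞, M)` when `M` has no non-zero vector fixed by `ker κ ⊓ I_v̄`**
(any number field, any `ℤ_p`-extension, any discrete `Γ_K`-module, any `S₀`): the two groups differ only in
the condition above `v̄` — Greenberg's inertia condition for Castella's strict datum `M⁺_v̄ = 0` (= unramified
at every place above `v̄`, all conjugates) versus the strict one (locally trivial) — and §2 identifies them
conjugate by conjugate (the hypothesis is conjugation-invariant: `conj_σ c` is tested on the SAME `ker κ ⊓ I_v̄`).
KY's case `θ|_{G_v̄} = ω`: "`𝓛(ℓ_{M_ω̃}) = 0` … `𝓛(ℓ_{M_ω̃[𝔭]}) = 0` … the above two diagrams agree".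
[cite: KellerYin2024, proof of Lemma 1.2.4 (arXiv:2402.12781v2 TeX L790–795)] [cite: Greenberg1989, §1 p. 98] -/
theorem grSelmer_eq_unrSelmer_of_noFixed
    (hI : ∀ m : M, (∀ g : absoluteGaloisGroup K, g ∈ κ.kerSubgroup → g ∈ inertia vbar → g • m = m) → m = 0) :
    grSelmer κ M vbar S₀ = unrSelmer κ M vbar S₀ := by
  refine le_antisymm (grSelmer_le_unrSelmer κ M vbar S₀) fun c hc ↦ ?_
  change c ∈ datumSelmer κ.kerSubgroup M p (Castella2018.AcSelmer.bdpData M p vbar) S₀ at hc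
  change c ∈ datumStrictSelmer κ.kerSubgroup M p (Castella2018.AcSelmer.bdpData M p vbar) S₀
  rw [mem_datumSelmer_iff] at hc
  rw [mem_datumStrictSelmer_iff]
  refine ⟨hc.1, fun v hv σ ↦ ?_⟩
  by_cases hv𝔭 : v = vbar
  · subst hv𝔭
    have h' := hc.2 v hv σ
    rw [Castella2018.AcSelmer.bdpData_self p v hv] at h' ⊢
    -- Greenberg's condition for the strict datum = unramified; strict condition = dies on `H ⊓ D_v`
    rw [mem_greenbergKer_strictDatum_iff] at h'
    rw [mem_strictKer_strictDatum_iff_resOfLe]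
    exact resOfLe_decomp_eq_zero_of_mem_unramifiedKer_of_noFixed κ.kerSubgroup v hI h'
  · rw [Castella2018.AcSelmer.bdpData_of_ne p vbar hv hv𝔭, Castella2018.AcSelmer.strictKer_relaxedDatum_eq_top]
    exact AddSubgroup.mem_top _

end Selmer

end Summit.BirchSwinnertonDyer.BirchSwinnertonDyer.Theorems.CharResidualSelmerCount

end
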